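import Summits.BirchSwinnertonDyer.Rank1Residual.AdditivePotMult.PotMultBranchPAdicGrossZagierRankOne
import Summits.BirchSwinnertonDyer.Rank1Residual.AdditivePotMult.PotMultRankOneKatoCertificate
import Summits.BirchSwinnertonDyer.Rank1Residual.Additive.GordBranchPAdicGrossZagierConverse
import HarnessLib

/-!
# T-O7c (ii), CONVERSE on the potentially MULTIPLICATIVE rows (M): given the branch main conjecture on
# the quadratic branch of `E♭` (p10's LOWER `QuadraticBranchLowerDivisibilityAt E♭` ∧ Kato's UPPER on
# the half-eigenspace, published, through n1011-p07's full-series brick) and Delbourgo's (B)-clauses in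
# case (M), `BSD(E,p)` in rank one IMPLIES the typed `p`-adic Gross–Zagier `BranchPAdicGrossZagierMultAt
# W p Dh` — EVERY odd `p`, `p = 3` included (cell `b2b-bsdres`, team n1011, seat p01 GEN 2, OWNERS row
# T-O7c; the (M) twin of `GordBranchPAdicGrossZagier[Odd]Converse.lean`, sequel of
# `PotMultBranchPAdicGrossZagier{,RankOne}.lean`)

HONEST FRAMING (cell `b2b-bsdres`, run/shared/lean/b2b/bsd-rank1-residual/, verbatim in every
file): prove what is provable now; shrink each hard class to its core with data; no claim beyond
stated classes. Research routes; census output = EVIDENCE / conjecture items, never a Literature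
fact; RESIDUAL-MAP marks change only by signed lines. §I O7 stays OPEN; X4(M) stays
CONSTRUCTION-SHAPED; nothing is booked; no label changes. COVERAGE (stated first, referee 1
proviso): the potentially multiplicative rows `E = E♭ ⊗ χ_{p*}`, `E♭ = V` MULTIPLICATIVE at the ODD
prime `p` (split / non-split; both parities of `(p−1)/2`; `p = 3` INCLUDED), `ρ̄_{E,p}` SURJECTIVE
(Kato's image hypothesis; the tower of `E♭` from surj(p) alone, n1011-p14 / lit-kato's proved
multiplicative case of Wuthrich 2014 Lemma 20, `PotMult.towerSurj_twist_of_surj`), `E` of analytic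
rank `1`; on (M) Delbourgo's `ℓ_p = 1` is AUTOMATIC (`PotMult.reductionNonAnomalous`) and there is NO
CM and NO `p ≥ 5` binder. The reducible-image (X3♯(M)) rows are NOT covered (Kato's half needs the
big image; the Wuthrich-Thm-16 twin is n1011-p12's row T-O7KM-X3 — not restated). NO definition, NO
Literature fact minted, NO `_holds`; theorems only. The `Λ`-algebra is gen 1's
`exists_unit_coeff_one_eq_of_lower_of_upper`; the UPPER brick is n1011-p07's
`AdditivePotMult.isTorsion_and_exists_iota_eq_of_katoHalf` (T-O7KM FILE 1) — both IMPORTED, nothing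
re-derived.

## What (the loop closes on (M))

`PotMultBranchPAdicGrossZagierRankOne.lean` proved `QuadraticBranchLowerDivisibilityAt E♭ ∧
BranchPAdicGrossZagierMultAt ⟹ CycLowerBoundAt ⟹ MissingLowerBoundAt` (with A190 + rider). HERE the
converse:

* §1 `branchPAdicGrossZagierMultAt_of_bsdp_of_quadraticBranchLower_of_katoHalf`: `BSDp W p` (Miller)
  ∧ the (B)-clauses for `Dh` ∧ the Schneider rider ∧ `PotMult W p` ∧ `Surj W p` ∧ p10's LOWER for every
  multiplicative twist model (`hc`, the binder shape of gen 1's class forms) ∧ Kato's half-eigen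
  divisibility (`hK`, `Wuthrich2014.kato_halfEigenCharIdeal_dvd_cyclotomicPrime_of_surjective`,
  PUBLISHED) ⟹ `BranchPAdicGrossZagierMultAt W p Dh` in analytic rank `1`. Proof: for an admissible
  `(V, C, f, B, ϖ)`, p07's brick gives `ι g = C(u·ϖ)·B` for some `g ∈ char_Λ X(E/ℚ_∞)` (UPPER); p10's
  conjecture, pulled back along additive-p2's descent `SelmerDualData.exists_chiEigenInCyclotomic`
  (same characteristic ideal), gives `ι fE = ι h·(ϖ·B)` (LOWER); (B) gives `fE(0) = 0` and
  `[T¹]fE·log_p γ·#T² = u_B·#Ш[p^∞]·Reg_p·Tam` (`ℓ = 1` automatic); gen 1's `Λ`-lemma pins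
  `ϖ[T¹]B = h(0)⁻¹[T¹]fE`; `BSD(E,p)` says `#Ш_an/#Ш[p^∞] ∈ ℤ_p^×`. NO Birch / Pal / GZK binder.
* §2 class forms on `PotMult W p` / X4(M) ∩ {`ρ̄_{E,p}` onto}, every odd `p`.
So on X4(M) ∩ surj, EVERY odd `p`, rank one, GIVEN the branch IMC on `E♭`'s quadratic branch (p10's
LOWER + Kato) and Delbourgo 2002 (M) (A190): the typed (M) `p`-adic Gross–Zagier is EQUIVALENT to the
`p`-part of BSD — it is EXACTLY the missing analytic input, not a stronger conjecture. With the (G-ord)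
siblings (even: gen 1; odd: `GordBranchPAdicGrossZagierOddConverse.lean`) this holds on EVERY
semistable-twist row of O7-ord with big image.

References: [Delbourgo2002] Thm. (B), Hypothesis p. 39, Example p. 40; [Kato2004Asterisque] Thm. 17.4
(3); [Wuthrich2014] §3, Cor. 19, Lemma 20; [GreenbergLNM1716] §5; [MazurTateTeitelbaum1986Invent]
§I.10, §I.13–I.14; [Miller2011LMS] Def. 1.1; [SkinnerUrban2014] Thm. 3.6.4 (shape of the LOWER input).
-/

noncomputable section

open scoped Classical MatrixGroups ModularForm NumberField

open CongruenceSubgroup WeierstrassCurve NumberField Literature.NumberTheory.EllipticCurves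
  Literature.NumberTheory.EllipticCurves.ModularForms
  Literature.NumberTheory.EllipticCurves.Rank1Residual
  Literature.NumberTheory.EllipticCurves.Rank1Residual.Typed
  Literature.NumberTheory.EllipticCurves.Delbourgo2002
  Literature.NumberTheory.GaloisRepresentations
  IsDedekindDomain

namespace Summit.BirchSwinnertonDyer.Rank1Residual.AdditivePotMult

open Additive

variable {W : WeierstrassCurve ℚ} [W.IsElliptic] [W.IsGloballyMinimal] {p : ℕ} [hp : Fact p.Prime]

/-! ### §1 The converse on (M): `BSD(E,p)` ∧ branch IMC on `E♭` ∧ (B)-clauses ⟹ the typed input -/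

omit [W.IsGloballyMinimal] in
/-- **CONVERSE ((M), rank one, EVERY odd `p` incl. `3`).** Let `E` (`W`) be additive potentially
multiplicative at `p` (`PotMult W p`), `ρ̄_{E,p}` surjective, of analytic rank `1`, and `Dh` a height
datum with Delbourgo's (B)-clauses and `Reg_p(E,Dh) ≠ 0`. IF `BSD(E,p)` holds (Miller), p10's LOWER
input `QuadraticBranchLowerDivisibilityAt V p` holds for every multiplicative twist model
`C • V^{(p*)} = W` (`hc`), and Kato's half-eigen divisibility (`hK`, PUBLISHED: Kato 2004 Thm. 17.4 (3)
as read in Wuthrich 2014 §3 / Cor. 19) is granted, THEN `BranchPAdicGrossZagierMultAt W p Dh`: for every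
admissible `(V, C, f, B, ϖ)`, `ϖ·[T¹]B·log_p γ = u·q·Reg_p(E,Dh)` with `u ∈ ℤ_p^×`, `q = #Ш_an·Tam/#T²`.
`ℓ_p = 1`, no CM and the `p`-adic tower of `E♭` are AUTOMATIC on (M). With gen 1's forward direction
(`cycLowerBoundAt_of_quadraticBranchLower_of_branchPAdicGrossZagierMult` + A190) the typed (M)
`p`-adic Gross–Zagier is EQUIVALENT to `BSD_p` on these rows modulo the branch IMC — nothing stronger
is conjectured. Binders: `hK` (published), modularity `hmod` (for `L'(E,1) ≠ 0`); NO Birch/Pal/GZK.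
[cite: Delbourgo2002, Theorem (B) (p. 40) and Hypothesis (p. 39)] [cite: Kato2004Asterisque, Thm. 17.4 (3) (p. 273)]
[cite: Wuthrich2014, §3 (p. 390), Cor. 19 (p. 398), Lemma 20 (p. 399)] [cite: Miller2011LMS, Def. 1.1]
[cite: GreenbergLNM1716, §5 (PDF p. 143)] -/
theorem PotMult.branchPAdicGrossZagierMultAt_of_bsdp_of_quadraticBranchLower_of_katoHalf
    (hK : Wuthrich2014.kato_halfEigenCharIdeal_dvd_cyclotomicPrime_of_surjective)
    (hmod : hasEntireLFunction_rat) {Dh : PAdicHeightData W p}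
    (hB : LeadingTermClauses W p Dh) (hS : SchneiderConjecture Dh) (hpm : PotMult W p)
    (hsurj : Surj W p) (hr : W.analyticRank = 1) (hbsd : BSDp W p)
    (hc : ∀ (V : WeierstrassCurve ℚ) [V.IsElliptic] [V.IsGloballyMinimal],
      (∃ C : VariableChange ℚ, C • V.quadraticTwist ((-1) ^ (p / 2) * p : ℚ) = W) →
        QuadraticBranchLowerDivisibilityAt V p) :
    BranchPAdicGrossZagierMultAt W p Dh := by
  intro V _ _ N _ f B hp2 hVW hVB hf ϖ hϖ
  have hpP : p.Prime := hp.out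
  have hna : ReductionNonAnomalous W p := hpm.reductionNonAnomalous
  obtain ⟨hrank, hfinp, s, hs, hvs⟩ := hbsd
  have hmw : W.mordellWeilRank = 1 := by rw [hrank, hr]
  obtain ⟨C, hC⟩ := hVW
  -- the cyclotomic setting, a dual datum, a generator of `char_Λ X(E/ℚ_∞)`
  obtain ⟨κ, hκ, γ, hγ, hγ'⟩ := exists_isCyclotomic_isTopGenerator_isCyclotomicVariable_holds p
  obtain ⟨D⟩ := W.nonempty_selmerDualData_holds κ γ hγ
  haveI : Module.Finite (IwasawaAlgebra p) D.X := D.module_finite_holds hγ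
  haveI : (Literature.NumberTheory.EllipticCurves.Module.charIdeal (IwasawaAlgebra p) D.X).IsPrincipal :=
    charIdeal_isPrincipal_holds p D.X
  obtain ⟨fE, hchar⟩ := Submodule.IsPrincipal.principal
    (Literature.NumberTheory.EllipticCurves.Module.charIdeal (IwasawaAlgebra p) D.X)
  have hcharE : D.charIdeal = Ideal.span {fE} := hchar
  -- UPPER (Kato on the half-eigenspace, full series, n1011-p07's brick): `ι g = C(u·ϖ)·B`, `g ∈ char`;
  -- the tower of `V = E♭` from surj(p) of `E` (multiplicative Lemma 20, proved in the tree)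
  have hsurjV : ∀ n : ℕ, V.HasSurjectiveModNGaloisRep (p ^ n : ℕ) :=
    hpm.towerSurj_twist_of_surj hp2 hsurj V C hC
  obtain ⟨hXt, g, hg, u, hι⟩ := isTorsion_and_exists_iota_eq_of_katoHalf hK hp2 V C hC hsurjV hκ hγ hγ'
    hf D B (Or.inr hVB) ϖ hϖ
  set G : PowerSeries ℚ_[p] := PowerSeries.C ((ϖ : ℚ) : ℚ_[p]) * B with hG_def
  have hgspan : g ∈ Ideal.span {fE} := by rw [← hcharE]; exact hg
  obtain ⟨k, hk⟩ := Ideal.mem_span_singleton'.mp hgspan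
  have hup : iwasawaToPowerSeries p (k * fE) = PowerSeries.C ((u : ℤ_[p]) : ℚ_[p]) * G := by
    rw [hk, hι, hG_def, ← mul_assoc, ← map_mul]
  -- LOWER (p10's `E♭`-level conjecture, pulled back along additive-p2's descent): `ι fE = ι h · G`
  haveI hcycL : IsCyclotomicExtension {p} ℚ (CyclotomicField p ℚ) := by
    have h : (CyclotomicField.algebra p ℚ : Algebra ℚ (CyclotomicField p ℚ)) =
        DivisionRing.toRatAlgebra := Subsingleton.elim _ _
    exact h ▸ CyclotomicField.isCyclotomicExtension p ℚ
  obtain ⟨K, θ, hK2, hθ, hθ2⟩ := exists_intermediateField_sq_eq_pStar p (CyclotomicField p ℚ) hp2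
  haveI : NumberField K := NumberField.of_module_finite ℚ K
  haveI : IsGalois ℚ K := isGalois_of_finrank_eq_two K hK2
  haveI := normal_galRange K hK2 (sigmaQ_ne_one K hK2 hθ hθ2)
  haveI := normal_galRange_cyclotomic p (CyclotomicField p ℚ)
  haveI : (V.quadraticTwist ((-1 : ℚ) ^ (p / 2) * p)).IsElliptic :=
    V.isElliptic_quadraticTwist (pStar_ne_zero p)
  obtain ⟨γ₁, hγ₁KF, hκγ₁, ⟨g₀, hg₀, hγ₁eq⟩, D', hchar', -⟩ :=
    SelmerDualData.exists_chiEigenInCyclotomic p (CyclotomicField p ℚ) V K hK2 hθ hθ2 κ hC hp2 D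
  have hmem : fE ∈ Literature.NumberTheory.EllipticCurves.Module.charIdeal (IwasawaAlgebra p) D'.X := by
    rw [hchar', hcharE]
    exact Ideal.mem_span_singleton_self fE
  obtain ⟨h, hlow⟩ := hc V ⟨C, hC⟩ K (CyclotomicField p ℚ) (κ := κ) (γ := γ₁) (f := f) B hp2 hK2
    ⟨θ, hθ2⟩ (Or.inr hVB) hκ (isTopGenerator_of_kappa_eq κ hκγ₁ hγ)
    (isCyclotomicVariable_of_eq_mul p κ hκ hg₀ hγ₁eq hγ') (Subgroup.mem_inf.mp hγ₁KF).1
    (Subgroup.mem_inf.mp hγ₁KF).2 hf D' ϖ hϖ fE hmem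
  -- (B): `fE(0) = 0` and the exact leading term (ℓ = 1 on (M))
  have hord1 : (W.mordellWeilRank : ℕ∞) ≤ fE.order := (hB κ γ hκ hγ hγ' D hXt fE hcharE).1
  have h0 : PowerSeries.constantCoeff fE = 0 := by
    rw [← PowerSeries.coeff_zero_eq_constantCoeff_apply]
    refine PowerSeries.coeff_of_lt_order 0 ?_
    rw [hmw, Nat.cast_one] at hord1
    exact lt_of_lt_of_le (by exact_mod_cast zero_lt_one) hord1
  obtain ⟨uB, hBeq⟩ := hB.leadingCoeff_of_nonAnomalous hκ hγ hγ' D hXt hcharE hS hfinp hna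
  rw [hmw, pow_one] at hBeq
  -- positivity / non-vanishing
  have hT0 : W.torsionOrder ≠ 0 := (W.torsionOrder_pos_holds).ne'
  have hTQ : (W.torsionOrder : ℚ_[p]) ≠ 0 := by exact_mod_cast hT0
  have hT2Q : (W.torsionOrder : ℚ_[p]) ^ 2 ≠ 0 := pow_ne_zero 2 hTQ
  have hPpos : 0 < W.tamagawaProduct := W.tamagawaProduct_pos_holds
  have hCQ : (W.tamagawaProduct : ℚ_[p]) ≠ 0 := by exact_mod_cast hPpos.ne'
  have hShp0 : (Nat.card (AddCommGroup.primaryComponent W.sha p) : ℚ_[p]) ≠ 0 := by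
    exact_mod_cast Nat.card_pos.ne'
  have huB0 : ((uB : ℤ_[p]) : ℚ_[p]) ≠ 0 := coe_units_ne_zero p uB
  have hRegp : padicRegulator Dh ≠ 0 := hS
  have hlog : padicLog p (cyclotomicGenerator p : ℚ_[p]) ≠ 0 := by
    obtain ⟨uγ, huγ⟩ := exists_unit_padicLog_cyclotomicGenerator p hp2
    rw [huγ]
    exact mul_ne_zero (Nat.cast_ne_zero.mpr hpP.ne_zero) (coe_units_ne_zero p uγ)
  have h1 : PowerSeries.coeff 1 fE ≠ 0 := by
    intro hz
    rw [hz, PadicInt.coe_zero, zero_mul, zero_mul] at hBeq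
    exact mul_ne_zero huB0 (mul_ne_zero (mul_ne_zero hShp0 hRegp) hCQ) hBeq.symm
  -- gen 1 §1: `[T¹] G = w · [T¹] fE`, `w ∈ ℤ_p^×`
  obtain ⟨w, hw⟩ := exists_unit_coeff_one_eq_of_lower_of_upper p hlow hup h0 h1
  -- the rational `q` (definition of the analytic Ш)
  have hΩpos : 0 < W.realPeriodRat := W.realPeriodRat_pos_holds
  have hRegpos : 0 < W.regulator := regulator_pos_holds W
  set q : ℚ := s * (W.tamagawaProduct : ℚ) / (W.torsionOrder : ℚ) ^ 2 with hq_def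
  have hlead : W.leadingLCoeff = (q : ℂ) * (W.realPeriodRat : ℂ) * (W.regulator : ℂ) := by
    have hΩC : (W.realPeriodRat : ℂ) ≠ 0 := by exact_mod_cast hΩpos.ne'
    have hRegC : (W.regulator : ℂ) ≠ 0 := by exact_mod_cast hRegpos.ne'
    have hTC : (W.torsionOrder : ℂ) ≠ 0 := by exact_mod_cast hT0
    have hPC : (W.tamagawaProduct : ℂ) ≠ 0 := by exact_mod_cast hPpos.ne'
    have h := hs
    rw [shaAn_def] at h
    rw [hq_def]
    push_cast
    rw [div_eq_iff (mul_ne_zero (mul_ne_zero hΩC hPC) hRegC)] at h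
    field_simp
    linear_combination h
  have hL0 : W.leadingLCoeff ≠ 0 := W.leadingLCoeff_ne_zero_holds (hmod W)
  have hs0 : s ≠ 0 := by
    intro hz
    apply hL0
    rw [hlead, hq_def, hz]
    simp
  -- the unit `#Ш[p^∞] / #Ш_an` — this is where `BSD(E,p)` enters
  have hsQ : ((s : ℚ) : ℚ_[p]) ≠ 0 := by exact_mod_cast hs0
  set t : ℚ_[p] := (Nat.card (AddCommGroup.primaryComponent W.sha p) : ℚ_[p]) / ((s : ℚ) : ℚ_[p])
    with ht_def
  have hnorm : ‖t‖ = 1 := by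
    have hnS : ‖(Nat.card (AddCommGroup.primaryComponent W.sha p) : ℚ_[p])‖ = ‖((s : ℚ) : ℚ_[p])‖ := by
      rw [Padic.norm_eq_zpow_neg_valuation hShp0, Padic.norm_eq_zpow_neg_valuation hsQ,
        Padic.valuation_natCast, Padic.valuation_ratCast, hvs]
    rw [ht_def, norm_div, hnS, div_self (norm_ne_zero_iff.mpr hsQ)]
  obtain ⟨wS, hwS⟩ := exists_unit_coe_eq_of_norm_eq_one p hnorm
  -- assemble
  refine ⟨w * uB * wS, q, hlead, ?_⟩
  have hG1 : PowerSeries.coeff 1 G = ((ϖ : ℚ) : ℚ_[p]) * PowerSeries.coeff 1 B := by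
    rw [hG_def, PowerSeries.coeff_C_mul]
  have hf1 : ((PowerSeries.coeff 1 fE : ℤ_[p]) : ℚ_[p]) =
      ((uB : ℤ_[p]) : ℚ_[p]) *
          ((Nat.card (AddCommGroup.primaryComponent W.sha p) : ℚ_[p]) * padicRegulator Dh *
            W.tamagawaProduct) /
        (padicLog p (cyclotomicGenerator p : ℚ_[p]) * (W.torsionOrder : ℚ_[p]) ^ 2) := by
    rw [eq_div_iff (mul_ne_zero hlog hT2Q), ← hBeq]
    ring
  rw [hmw, pow_one, ← hG1, hw, Units.val_mul, Units.val_mul, PadicInt.coe_mul, PadicInt.coe_mul, hwS,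
    ht_def, hq_def, hf1]
  push_cast
  field_simp

/-! ### §2 Class forms: X4(M) ∩ {`ρ̄_{E,p}` onto}, every odd `p`, rank one -/

omit [W.IsGloballyMinimal] in
/-- **Class form: X4(M) ∩ {`ρ̄_{E,p}` onto}, EVERY odd `p` (`p = 3` included; `p ≠ 2` is part of
`ClassX4`), `r_an = 1`.** For every height datum with Delbourgo's (B)-clauses and the rider:
`BSD(E,p)` ∧ p10's LOWER on every multiplicative twist model ∧ Kato's half (published) ⟹
`BranchPAdicGrossZagierMultAt W p Dh` — the converse of gen 1's
`ClassX4M.missingLowerBoundAt_rankOne_of_quadraticBranchLower_of_branchPAdicGrossZagierMult` (which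
takes A190 to PRODUCE the clauses; here they are a hypothesis). X4(M) stays CONSTRUCTION-SHAPED;
nothing booked. [cite: Delbourgo2002, Theorem (B) (p. 40)] [cite: Kato2004Asterisque, Thm. 17.4 (3) (p. 273)]
[cite: Miller2011LMS, Def. 1.1] -/
theorem ClassX4M.branchPAdicGrossZagierMultAt_of_bsdp_of_quadraticBranchLower_of_katoHalf
    (hK : Wuthrich2014.kato_halfEigenCharIdeal_dvd_cyclotomicPrime_of_surjective)
    (hmod : hasEntireLFunction_rat) (hX : ClassX4M W p) (hsurj : Surj W p) (hr : W.analyticRank = 1)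
    (hbsd : BSDp W p)
    (hc : ∀ (V : WeierstrassCurve ℚ) [V.IsElliptic] [V.IsGloballyMinimal],
      (∃ C : VariableChange ℚ, C • V.quadraticTwist ((-1) ^ (p / 2) * p : ℚ) = W) →
        QuadraticBranchLowerDivisibilityAt V p)
    {Dh : PAdicHeightData W p} (hB : LeadingTermClauses W p Dh) (hS : SchneiderConjecture Dh) :
    BranchPAdicGrossZagierMultAt W p Dh :=
  (ClassX4M.potMult W p hX).branchPAdicGrossZagierMultAt_of_bsdp_of_quadraticBranchLower_of_katoHalf hK
    hmod hB hS hsurj hr hbsd hc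

omit [W.IsGloballyMinimal] in
/-- **`∀ Dh` form** (the exact converse of the hypothesis shape `hGZ` of gen 1's
`ClassX4M.missingLowerBoundAt_rankOne_of_quadraticBranchLower_of_branchPAdicGrossZagierMult`, minus the
rider which is an input here): on X4(M) ∩ {`ρ̄_{E,p}` onto}, every odd `p`, `r_an = 1`: `BSD(E,p)` ∧
p10's LOWER ∧ Kato's half ⟹ for EVERY height datum with the (B)-clauses and the rider,
`BranchPAdicGrossZagierMultAt W p Dh`. [cite: Delbourgo2002, Theorem (B) (p. 40)] [cite: Miller2011LMS, Def. 1.1] -/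
theorem ClassX4M.forall_branchPAdicGrossZagierMultAt_of_bsdp_of_quadraticBranchLower_of_katoHalf
    (hK : Wuthrich2014.kato_halfEigenCharIdeal_dvd_cyclotomicPrime_of_surjective)
    (hmod : hasEntireLFunction_rat) (hX : ClassX4M W p) (hsurj : Surj W p) (hr : W.analyticRank = 1)
    (hbsd : BSDp W p)
    (hc : ∀ (V : WeierstrassCurve ℚ) [V.IsElliptic] [V.IsGloballyMinimal],
      (∃ C : VariableChange ℚ, C • V.quadraticTwist ((-1) ^ (p / 2) * p : ℚ) = W) →
        QuadraticBranchLowerDivisibilityAt V p) :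
    ∀ Dh : PAdicHeightData W p, LeadingTermClauses W p Dh → SchneiderConjecture Dh →
      BranchPAdicGrossZagierMultAt W p Dh :=
  fun _ hB hS ↦ hX.branchPAdicGrossZagierMultAt_of_bsdp_of_quadraticBranchLower_of_katoHalf hK hmod hsurj
    hr hbsd hc hB hS

end Summit.BirchSwinnertonDyer.Rank1Residual.AdditivePotMult

end
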